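import Summits.QuantumFields.YangMills.Theorems.BalabanUVNodesN19BirkhoffContraction
import Summits.QuantumFields.YangMills.Theorems.BalabanUVNodesN19RekeyingAscent

/-!
# BalabanUVNodes ∕ N19 (NE7) — `Spine.NE7.Core` UNDER A STEP COMMON TO BOTH RUNS: a non-negative kernel never widens it (Birkhoff
# monotonicity, source-dependent kernels allowed, NO normalisation); the SOURCE half of the width is rigid; the CLASS half contracts by
# Birkhoff's coefficient `tanh(Δ∕4)` under rows of cross-ratio diameter `≤ Δ` — so `K` common steps make a class-oscillation born once
# GEOMETRIC in `K`, and with the totals matched (node U5's DECL-target currency) N19's ∃δ-edge follows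

Cell `pub-ymgap` (HUMAN RULING D-0062 Track A; D-0149 width seats), seat `pub-ymgap-dag-n19-w2` (WIDTH SEAT 2 of 3 on NODE n19 = NE7), generation
g6, CLAIM-1 (INBOX l.32074, DECL-DELTA-1 l.32339).  Route `Summits/QuantumFields/YangMills/Theses/BalabanUVNodes.lean`, key item K3⁷
`SpineGivenEndpointR13SepCoPH` (stmt-QuantumFields-20544; the N19′ conjunct `KeyedCoreEdgeHolderD4 … → ∃ δ, NE7.Core … δ ∧ Summable δ` of v5 stub 2);
filed `--kind proof --supports … --as helper`.  COUNT-NEUTRAL.  THEOREMS ONLY (0 `def`, 0 `sorry`).  ADDITIVE — imports this seat's g6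
`…N19BirkhoffContraction` (Birkhoff's theorem in cross-ratio form: `two_rows_le_exp_tanh_mul`, `chain_dist_le_pow`, `tanh_quarter_*`,
`summable_tanh_quarter_pow_mul`) and dag-n19-w1's `…N19RekeyingAscent` (`coreEdge_of_totals_of_classOsc`; through it `Spine/NE7/Targets`: `Core`)
ONLY; cites BY NAME, restates nothing: dag-n19-w1 `N19RekeyingCalculus.core_classVal` (descent along a CLASS MAP = §1 at the 0-1 fibre kernel),
dag-n19-e `N19CoreMetric.core_common_mul_iff` (§1 at a diagonal kernel) ∕ `core_iff_logRatio_osc_le` (`Core` ⟺ joint (source, class)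
oscillation of `log(Q∕P)` `≤ 2·vol·δ_K`), dag-n19-w1 `N19RekeyingAscent.core_of_totals_of_classOsc` (`Core` ⟸ totals matched source-uniformly +
PER-SOURCE class-oscillation) — the split §2–§4 act on.

THE PICTURE.  In the two-run comparison behind NE7 (run A: `K` steps from spacing `L^{−K}`; run B: `K + 1` steps from `L^{−K−1}`, same torus, same
unit-lattice field) the discrepancy is BORN at run B's extra finest step and then BOTH runs apply the SAME `K` renormalisation steps — each a
positive linear map on densities (integration against a non-negative kernel; fluctuation integral ∘ averaging; NOT a Markov kernel: no
normalisation, and it may depend on the source `t` through the observable's insertion).  What such a common step does to `Core`'s width: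
* §1 ★★ `core_kernel_of_core` — NEVER WIDENS IT, with the SAME constants `c_K` and the SAME `δ`: `Core l₀ vol T Bad P Q δ` and a common
  non-negative source-dependent kernel `M K t σ τ` whose good rows put no mass on bad columns ⇒ `Core l₀ vol T′ Bad′ (M•P) (M•Q) δ`
  (`(M•P) K t σ = Σ_{τ ∈ T K} M K t σ τ · P K t τ`).  This is Birkhoff's weak contraction (cone-preserving linear maps do not expand Hilbert's
  metric) in N19's letters; dag-n19-w1's `core_classVal` is the instance `M = 𝟙[π τ = σ]`, dag-n19-e's `core_common_mul_iff` the diagonal one,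
  and it is the `Core` twin of this seat's g4 TV data processing (`…N19TVKernelChain.abs_comp_real_sub_comp_real_le_base`) — but for UNNORMALISED
  kernels, which is what RG steps are.
* §2 ★★ `core_expSource_iff` · `kernel_expSource` · ★ `core_kernel_expSource_iff` — THE SOURCE HALF IS RIGID: a class-independent, source-dependent
  discrepancy `Q = e^{f(K,t)}·P` has `Core … P Q δ ⟺ ∀ K ∃ c ∀ |t| ≤ l₀, |f K t − c| ≤ vol·δ_K` (node U5's `MatchingModConstants` shape for `f`),
  and `M•Q = e^{f(K,t)}·(M•P)` for EVERY kernel: no common step changes that condition.  (A step common to both runs is block-diagonal in the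
  source, so its projective diameter across sources is infinite: the observable's renormalisation is NOT produced by common steps.)
* §3 ★★ `classOsc_kernel_le_tanh_mul` — THE CLASS HALF CONTRACTS: if at each source value the log-ratio `log Q − log P` has class-oscillation
  `≤ ω_K` over the good classes (dag-n19-w1's per-source letter, here with bad classes), the kernel's good rows are POSITIVE on the good columns
  and vanish on the bad ones, and their cross-ratios are bounded, `M σ τ · M σ′ τ′ ≤ e^{Δ_K} · M σ τ′ · M σ′ τ` (projective diameter `≤ Δ_K`), then
  `(M•P, M•Q)` satisfy the same letter at `tanh(Δ_K∕4)·ω_K` — Birkhoff's coefficient (`…N19BirkhoffContraction.two_rows_le_exp_tanh_mul` BY NAME).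
  ★ `classOsc_kernel_le_self` — with merely NON-NEGATIVE rows the letter passes at `ω_K` unchanged (weak bound I).
* §4 ★★ `classOsc_chain_le_pow` · ★★★ `coreEdge_of_totals_of_commonSteps` — THE GEOMETRIC MECHANISM, END TO END: at level `K` a chain of `K`
  common positive steps of diameter `≤ Δ` acting (at each source value) on the two runs' class vectors, whose INITIAL class-oscillation is `≤ ω₀`
  (NOT small — born `O(1)` at the finest step), leaves a final class-oscillation `≤ tanh(Δ∕4)^K·ω₀` — GEOMETRIC in `K`, hence summable; with the
  TOTALS matched source-uniformly at a summable rate (node U5's DECL target `MatchingModConstants` read at one class) dag-n19-w1's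
  `coreEdge_of_totals_of_classOsc` BY NAME gives N19's slot `∃ δ, Core l₀ vol S ∅ P Q δ ∧ Summable δ`.  Contrast this seat's g2
  `…N19CoreScaleChain.not_summable_chainRadius_of_const_birth` (a CONSTANT birth AT EVERY LEVEL `j` is not summable under contraction): here ONE
  birth at stage `0` and `K` contractions — node U6's geometric age transport `ρ = tanh(Δ∕4)` is PRODUCED for the class half, not assumed.

HONEST FRAMING.  [folklore]-grade positive-operator theory (Birkhoff 1957 ∕ Hopf 1963; Eveson–Nussbaum 1995 Thm 3.5) on hypothesis SHAPES produced by
nobody.  ZERO Bałaban content: NO step of [Balaban1988Convergent] ∕ [Balaban1989LargeFieldI ∕ II] is shown to be a positive kernel of finite projective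
diameter on the good classes — and for a realistic lattice step the diameter is EXTENSIVE in the block volume (for a Boltzmann kernel `e^{−A(σ,τ)}`,
`Δ ≤ 2·osc A`, so `tanh(Δ∕4) = 1 − O(e^{−osc A∕ 2})`): the mechanism is real, its coefficient is NOT uniformly `< 1` in the volume unless localised
(cluster-expansion territory), and the source half (§2) is exactly node U5's DECL target, which no common step supplies.  NE2–NE7 ∕ NE1′ NOT PRINTED for
d = 4 ∕ NOT proved; N19 NOT discharged; K3⁷ OPEN, v5 untouched, not claimed; counts UNMOVED (typed 28∕28 · discharged 5∕27, A 5∕28); no count claim.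
One finite 𝕋⁴ programme at fixed ε, Bałaban AS PRINTED; R4 closes the conditional finite-𝕋⁴ rung `BalabanLadder.UV` only — the YM mass gap (Clay) is
NOT proved by any of this; nothing continuum ∕ ℝ⁴ ∕ OS.  No `def`, no `instance`, no `sorry`; standard axioms.
-/

noncomputable section

open Finset Real
open Summit.QuantumFields.BalabanUV.T4Continuum.Spine
open Summit.QuantumFields.YangMills.BalabanUVNodes.N19BirkhoffContraction
  (two_rows_le_exp_tanh_mul two_rows_le_exp_dist chain_dist_le_pow tanh_quarter_nonneg tanh_quarter_lt_one summable_tanh_quarter_pow_mul)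
open Summit.QuantumFields.YangMills.BalabanUVNodes.N19RekeyingAscent (coreEdge_of_totals_of_classOsc)

namespace Summit.QuantumFields.YangMills.BalabanUVNodes.N19CoreCommonStep

/-! ## §0 Two dictionary lemmas between the log-ratio letter and the cross-ratio letter [folklore] -/

/-- log-difference `≤ ω` ⇒ cross-ratio `≤ e^ω`: for positive `p, q, p′, q′`,
`(log q − log p) − (log q′ − log p′) ≤ ω ⇒ q·p′ ≤ e^ω·(p·q′)`. [folklore] -/
theorem mul_le_exp_mul_of_logRatio_sub_le {p q p' q' ω : ℝ} (hp : 0 < p) (hq : 0 < q) (hp' : 0 < p') (hq' : 0 < q')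
    (h : (Real.log q - Real.log p) - (Real.log q' - Real.log p') ≤ ω) : q * p' ≤ exp ω * (p * q') := by
  have hl : Real.log (q * p') ≤ Real.log (exp ω * (p * q')) := by
    rw [Real.log_mul hq.ne' hp'.ne', Real.log_mul (exp_pos ω).ne' (mul_pos hp hq').ne', Real.log_mul hp.ne' hq'.ne',
      Real.log_exp]
    linarith
  exact (Real.log_le_log_iff (mul_pos hq hp') (by positivity)).1 hl

/-- cross-ratio `≤ e^ω` ⇒ log-difference `≤ ω`: for positive `p, q, p′, q′`,
`q·p′ ≤ e^ω·(p·q′) ⇒ (log q − log p) − (log q′ − log p′) ≤ ω`. [folklore] -/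
theorem logRatio_sub_le_of_mul_le_exp_mul {p q p' q' ω : ℝ} (hp : 0 < p) (hq : 0 < q) (hp' : 0 < p') (hq' : 0 < q')
    (h : q * p' ≤ exp ω * (p * q')) : (Real.log q - Real.log p) - (Real.log q' - Real.log p') ≤ ω := by
  have hl := Real.log_le_log (mul_pos hq hp') h
  rw [Real.log_mul hq.ne' hp'.ne', Real.log_mul (exp_pos ω).ne' (mul_pos hp hq').ne', Real.log_mul hp.ne' hq'.ne',
    Real.log_exp] at hl
  linarith

/-! ## §1 A common non-negative step never widens `Core` (Birkhoff monotonicity; source-dependent kernels, no normalisation) -/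

section Monotone

variable {ι κ : Type*} [DecidableEq ι] [DecidableEq κ] {l₀ vol : ℝ} {T : ℕ → Finset ι} {Bad : ℕ → ℝ → Finset ι}
  {T' : ℕ → Finset κ} {Bad' : ℕ → ℝ → Finset κ} {P Q : ℕ → ℝ → ι → ℝ} {δ : ℕ → ℝ} {M : ℕ → ℝ → κ → ι → ℝ}

/-- **★★ A COMMON NON-NEGATIVE STEP NEVER WIDENS `Core`** [folklore] (Birkhoff's weak contraction in N19's letters).  If the two runs' cores are
matched, `Core l₀ vol T Bad P Q δ`, and BOTH are pushed through the SAME non-negative kernel `M K t σ τ` — source-dependent allowed, NOT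
normalised — whose good rows `σ ∈ T′ K ∖ Bad′ K t` put no mass on the bad columns `τ ∈ T K ∩ Bad K t`, then the images
`(M•P) K t σ = Σ_{τ ∈ T K} M K t σ τ · P K t τ`, `(M•Q)` are matched with the SAME constants and the SAME `δ`:
`Core l₀ vol T′ Bad′ (M•P) (M•Q) δ`.  No positivity of `P` is needed.  Instances in tree: dag-n19-w1 `N19RekeyingCalculus.core_classVal`
(`M = 𝟙[π K τ = σ]`, its `hcover` = the support clause), dag-n19-e `N19CoreMetric.core_common_mul_iff` (diagonal `M`). -/
theorem core_kernel_of_core (h : NE7.Core l₀ vol T Bad P Q δ)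
    (hM : ∀ (K : ℕ) (t : ℝ), |t| ≤ l₀ → ∀ σ ∈ T' K \ Bad' K t, ∀ τ ∈ T K, 0 ≤ M K t σ τ)
    (hsupp : ∀ (K : ℕ) (t : ℝ), |t| ≤ l₀ → ∀ σ ∈ T' K \ Bad' K t, ∀ τ ∈ T K, τ ∈ Bad K t → M K t σ τ = 0) :
    NE7.Core l₀ vol T' Bad' (fun K t σ => ∑ τ ∈ T K, M K t σ τ * P K t τ)
      (fun K t σ => ∑ τ ∈ T K, M K t σ τ * Q K t τ) δ := by
  intro K
  obtain ⟨c, hc⟩ := h K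
  refine ⟨c, fun t ht σ hσ => ?_⟩
  have key : ∀ τ ∈ T K, Real.exp (c - vol * δ K) * (M K t σ τ * P K t τ) ≤ M K t σ τ * Q K t τ ∧
      M K t σ τ * Q K t τ ≤ Real.exp (c + vol * δ K) * (M K t σ τ * P K t τ) := by
    intro τ hτ
    by_cases hb : τ ∈ Bad K t
    · simp [hsupp K t ht σ hσ τ hτ hb]
    · obtain ⟨h1, h2⟩ := hc t ht τ (Finset.mem_sdiff.2 ⟨hτ, hb⟩)
      have hm := hM K t ht σ hσ τ hτ
      constructor
      · calc Real.exp (c - vol * δ K) * (M K t σ τ * P K t τ) = M K t σ τ * (Real.exp (c - vol * δ K) * P K t τ) := by ring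
          _ ≤ M K t σ τ * Q K t τ := mul_le_mul_of_nonneg_left h1 hm
      · calc M K t σ τ * Q K t τ ≤ M K t σ τ * (Real.exp (c + vol * δ K) * P K t τ) := mul_le_mul_of_nonneg_left h2 hm
          _ = Real.exp (c + vol * δ K) * (M K t σ τ * P K t τ) := by ring
  constructor
  · rw [Finset.mul_sum]; exact Finset.sum_le_sum fun τ hτ => (key τ hτ).1
  · rw [Finset.mul_sum]; exact Finset.sum_le_sum fun τ hτ => (key τ hτ).2

/-- The edge form: N19's slot `∃ δ, Core … ∧ Summable δ` passes through a common non-negative step unchanged. [folklore] -/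
theorem coreEdge_kernel_of_coreEdge (h : ∃ δ : ℕ → ℝ, NE7.Core l₀ vol T Bad P Q δ ∧ Summable δ)
    (hM : ∀ (K : ℕ) (t : ℝ), |t| ≤ l₀ → ∀ σ ∈ T' K \ Bad' K t, ∀ τ ∈ T K, 0 ≤ M K t σ τ)
    (hsupp : ∀ (K : ℕ) (t : ℝ), |t| ≤ l₀ → ∀ σ ∈ T' K \ Bad' K t, ∀ τ ∈ T K, τ ∈ Bad K t → M K t σ τ = 0) :
    ∃ δ : ℕ → ℝ, NE7.Core l₀ vol T' Bad' (fun K t σ => ∑ τ ∈ T K, M K t σ τ * P K t τ)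
      (fun K t σ => ∑ τ ∈ T K, M K t σ τ * Q K t τ) δ ∧ Summable δ := by
  obtain ⟨δ, hc, hδ⟩ := h
  exact ⟨δ, core_kernel_of_core hc hM hsupp, hδ⟩

end Monotone

/-! ## §2 The source half is rigid: a class-independent, source-dependent discrepancy passes through every common step -/

section Source

variable {ι κ : Type*} [DecidableEq ι] [DecidableEq κ] {l₀ vol : ℝ} {T : ℕ → Finset ι} {Bad : ℕ → ℝ → Finset ι}
  {T' : ℕ → Finset κ} {Bad' : ℕ → ℝ → Finset κ} {P : ℕ → ℝ → ι → ℝ} {δ : ℕ → ℝ} {M : ℕ → ℝ → κ → ι → ℝ} {f : ℕ → ℝ → ℝ}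

/-- **★★ `Core` OF A PURE SOURCE DISCREPANCY** [folklore]: for positive run-A cores on non-empty good classes and `Q = e^{f(K,t)}·P`
(class-INDEPENDENT, source-dependent ratio), `Core l₀ vol T Bad P Q δ ⟺ ∀ K ∃ c ∀ |t| ≤ l₀, |f K t − c| ≤ vol·δ_K` — node U5's
`MatchingModConstants` shape for the exponent `f`; `Core`'s class clause is idle here, only the SOURCE-UNIFORMITY of `c_K` bites. -/
theorem core_expSource_iff (hP : ∀ (K : ℕ) (t : ℝ), |t| ≤ l₀ → ∀ τ ∈ T K \ Bad K t, 0 < P K t τ)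
    (hne : ∀ (K : ℕ) (t : ℝ), |t| ≤ l₀ → (T K \ Bad K t).Nonempty) :
    NE7.Core l₀ vol T Bad P (fun K t τ => Real.exp (f K t) * P K t τ) δ ↔
      ∀ K : ℕ, ∃ c : ℝ, ∀ t : ℝ, |t| ≤ l₀ → |f K t - c| ≤ vol * δ K := by
  constructor
  · intro h K
    obtain ⟨c, hc⟩ := h K
    refine ⟨c, fun t ht => ?_⟩
    obtain ⟨τ, hτ⟩ := hne K t ht
    have hp := hP K t ht τ hτ
    obtain ⟨h1, h2⟩ := hc t ht τ hτ
    have h1' : Real.exp (c - vol * δ K) ≤ Real.exp (f K t) := le_of_mul_le_mul_right h1 hp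
    have h2' : Real.exp (f K t) ≤ Real.exp (c + vol * δ K) := le_of_mul_le_mul_right h2 hp
    rw [Real.exp_le_exp] at h1' h2'
    exact abs_le.2 ⟨by linarith, by linarith⟩
  · intro h K
    obtain ⟨c, hc⟩ := h K
    refine ⟨c, fun t ht τ hτ => ?_⟩
    have hp := (hP K t ht τ hτ).le
    obtain ⟨h1, h2⟩ := abs_le.1 (hc t ht)
    exact ⟨mul_le_mul_of_nonneg_right (Real.exp_le_exp.2 (by linarith)) hp,
      mul_le_mul_of_nonneg_right (Real.exp_le_exp.2 (by linarith)) hp⟩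

omit [DecidableEq ι] [DecidableEq κ] in
/-- A pure source discrepancy COMMUTES with every kernel: `M•(e^{f(K,t)}·P) = e^{f(K,t)}·(M•P)`. [folklore] -/
theorem kernel_expSource (M : ℕ → ℝ → κ → ι → ℝ) (P : ℕ → ℝ → ι → ℝ) (f : ℕ → ℝ → ℝ) (K : ℕ) (t : ℝ) (σ : κ) :
    ∑ τ ∈ T K, M K t σ τ * (Real.exp (f K t) * P K t τ) = Real.exp (f K t) * ∑ τ ∈ T K, M K t σ τ * P K t τ := by
  rw [Finset.mul_sum]
  exact Finset.sum_congr rfl fun τ _ => by ring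

/-- **★ NO COMMON STEP TOUCHES THE SOURCE HALF** [folklore]: for a pure source discrepancy `Q = e^{f(K,t)}·P` and ANY kernel `M` (positive images
of `P` on the non-empty good rows, positive `P` on the non-empty good columns), `Core … (M•P) (M•Q) δ ⟺ Core … P Q δ` — both say
`∀ K ∃ c ∀ |t| ≤ l₀, |f K t − c| ≤ vol·δ_K`.  A step common to both runs is block-diagonal in the source: its projective diameter ACROSS sources
is infinite, and the source-uniformity of `Core`'s constant (the observable's renormalisation, node U5's DECL target) is not produced by it. -/
theorem core_kernel_expSource_iff (hP : ∀ (K : ℕ) (t : ℝ), |t| ≤ l₀ → ∀ τ ∈ T K \ Bad K t, 0 < P K t τ)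
    (hne : ∀ (K : ℕ) (t : ℝ), |t| ≤ l₀ → (T K \ Bad K t).Nonempty)
    (hMP : ∀ (K : ℕ) (t : ℝ), |t| ≤ l₀ → ∀ σ ∈ T' K \ Bad' K t, 0 < ∑ τ ∈ T K, M K t σ τ * P K t τ)
    (hne' : ∀ (K : ℕ) (t : ℝ), |t| ≤ l₀ → (T' K \ Bad' K t).Nonempty) :
    NE7.Core l₀ vol T' Bad' (fun K t σ => ∑ τ ∈ T K, M K t σ τ * P K t τ)
        (fun K t σ => ∑ τ ∈ T K, M K t σ τ * (Real.exp (f K t) * P K t τ)) δ ↔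
      NE7.Core l₀ vol T Bad P (fun K t τ => Real.exp (f K t) * P K t τ) δ := by
  have e : (fun K t σ => ∑ τ ∈ T K, M K t σ τ * (Real.exp (f K t) * P K t τ))
      = fun K t σ => Real.exp (f K t) * ∑ τ ∈ T K, M K t σ τ * P K t τ := by
    funext K t σ; exact kernel_expSource M P f K t σ
  rw [e, core_expSource_iff hMP hne', core_expSource_iff hP hne]

end Source

/-! ## §3 The class half contracts by Birkhoff's coefficient -/

section ClassHalf

variable {ι κ : Type*} [DecidableEq ι] [DecidableEq κ] {l₀ : ℝ} {T : ℕ → Finset ι} {Bad : ℕ → ℝ → Finset ι}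
  {T' : ℕ → Finset κ} {Bad' : ℕ → ℝ → Finset κ} {P Q : ℕ → ℝ → ι → ℝ} {ω Δ : ℕ → ℝ} {M : ℕ → ℝ → κ → ι → ℝ}

omit [DecidableEq κ] in
/-- the image over the full class set equals the image over the GOOD columns when the good row vanishes on the bad ones. [folklore] -/
theorem sum_eq_sum_good {K : ℕ} {t : ℝ} {σ : κ} (R : ι → ℝ)
    (hsupp : ∀ τ ∈ T K, τ ∈ Bad K t → M K t σ τ = 0) :
    ∑ τ ∈ T K, M K t σ τ * R τ = ∑ τ ∈ T K \ Bad K t, M K t σ τ * R τ := by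
  rw [← Finset.sum_sdiff (Finset.sdiff_subset : T K \ Bad K t ⊆ T K)]
  have hz : ∑ τ ∈ T K \ (T K \ Bad K t), M K t σ τ * R τ = 0 := by
    refine Finset.sum_eq_zero fun τ hτ => ?_
    obtain ⟨hT, hn⟩ := Finset.mem_sdiff.1 hτ
    have hb : τ ∈ Bad K t := by
      by_contra hb; exact hn (Finset.mem_sdiff.2 ⟨hT, hb⟩)
    simp [hsupp τ hT hb]
  rw [hz, zero_add]

/-- **★ WEAK BOUND: THE PER-SOURCE CLASS-OSCILLATION LETTER PASSES A COMMON NON-NEGATIVE STEP UNCHANGED** [folklore].  Positive cores `P, Q` on the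
good classes whose log-ratio has, at each source value, class-oscillation `≤ ω_K`; a common kernel whose good rows are non-negative on the good
columns, vanish on the bad ones and give positive images; then `(M•P, M•Q)` satisfy the same letter at `ω_K`
(`…N19BirkhoffContraction.two_rows_le_exp_dist`). -/
theorem classOsc_kernel_le_self
    (hP : ∀ (K : ℕ) (t : ℝ), |t| ≤ l₀ → ∀ τ ∈ T K \ Bad K t, 0 < P K t τ)
    (hQ : ∀ (K : ℕ) (t : ℝ), |t| ≤ l₀ → ∀ τ ∈ T K \ Bad K t, 0 < Q K t τ)
    (hM : ∀ (K : ℕ) (t : ℝ), |t| ≤ l₀ → ∀ σ ∈ T' K \ Bad' K t, ∀ τ ∈ T K \ Bad K t, 0 ≤ M K t σ τ)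
    (hsupp : ∀ (K : ℕ) (t : ℝ), |t| ≤ l₀ → ∀ σ ∈ T' K \ Bad' K t, ∀ τ ∈ T K, τ ∈ Bad K t → M K t σ τ = 0)
    (hMP : ∀ (K : ℕ) (t : ℝ), |t| ≤ l₀ → ∀ σ ∈ T' K \ Bad' K t, 0 < ∑ τ ∈ T K, M K t σ τ * P K t τ)
    (hMQ : ∀ (K : ℕ) (t : ℝ), |t| ≤ l₀ → ∀ σ ∈ T' K \ Bad' K t, 0 < ∑ τ ∈ T K, M K t σ τ * Q K t τ)
    (hosc : ∀ (K : ℕ) (t : ℝ), |t| ≤ l₀ → ∀ τ ∈ T K \ Bad K t, ∀ τ' ∈ T K \ Bad K t,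
      (Real.log (Q K t τ) - Real.log (P K t τ)) - (Real.log (Q K t τ') - Real.log (P K t τ')) ≤ ω K) :
    ∀ (K : ℕ) (t : ℝ), |t| ≤ l₀ → ∀ σ ∈ T' K \ Bad' K t, ∀ σ' ∈ T' K \ Bad' K t,
      (Real.log (∑ τ ∈ T K, M K t σ τ * Q K t τ) - Real.log (∑ τ ∈ T K, M K t σ τ * P K t τ)) -
        (Real.log (∑ τ ∈ T K, M K t σ' τ * Q K t τ) - Real.log (∑ τ ∈ T K, M K t σ' τ * P K t τ)) ≤ ω K := by
  intro K t ht σ hσ σ' hσ'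
  refine logRatio_sub_le_of_mul_le_exp_mul (hMP K t ht σ hσ) (hMQ K t ht σ hσ) (hMP K t ht σ' hσ') (hMQ K t ht σ' hσ') ?_
  rw [sum_eq_sum_good (Q K t) (hsupp K t ht σ hσ), sum_eq_sum_good (P K t) (hsupp K t ht σ hσ),
    sum_eq_sum_good (Q K t) (hsupp K t ht σ' hσ'), sum_eq_sum_good (P K t) (hsupp K t ht σ' hσ')]
  exact two_rows_le_exp_dist (s := T K \ Bad K t) (a := M K t σ) (b := M K t σ') (x := P K t) (y := Q K t)
    (hM K t ht σ hσ) (hM K t ht σ' hσ')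
    (fun τ hτ τ' hτ' => mul_le_exp_mul_of_logRatio_sub_le (hP K t ht τ hτ) (hQ K t ht τ hτ) (hP K t ht τ' hτ') (hQ K t ht τ' hτ')
      (hosc K t ht τ hτ τ' hτ'))

/-- **★★ THE CLASS HALF CONTRACTS BY BIRKHOFF's COEFFICIENT** [folklore] (Birkhoff 1957; Eveson–Nussbaum 1995 Thm 3.5, in N19's letters).  Positive
cores `P, Q` on the good classes whose log-ratio has, at each source value `|t| ≤ l₀`, class-oscillation `≤ ω_K` (`ω_K ≥ 0`); a common kernel whose
good rows are POSITIVE on the good columns and vanish on the bad ones, with cross-ratios bounded on good rows × good columns,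
`M σ τ · M σ′ τ′ ≤ e^{Δ_K} · M σ τ′ · M σ′ τ` (projective diameter `≤ Δ_K`, `Δ_K ≥ 0`).  Then the images `(M•P, M•Q)` satisfy the same letter at
`tanh(Δ_K∕4) · ω_K` (`…N19BirkhoffContraction.two_rows_le_exp_tanh_mul` BY NAME at each `(K, t, σ, σ′)`). -/
theorem classOsc_kernel_le_tanh_mul (hω : ∀ K, 0 ≤ ω K) (hΔ : ∀ K, 0 ≤ Δ K)
    (hP : ∀ (K : ℕ) (t : ℝ), |t| ≤ l₀ → ∀ τ ∈ T K \ Bad K t, 0 < P K t τ)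
    (hQ : ∀ (K : ℕ) (t : ℝ), |t| ≤ l₀ → ∀ τ ∈ T K \ Bad K t, 0 < Q K t τ)
    (hM : ∀ (K : ℕ) (t : ℝ), |t| ≤ l₀ → ∀ σ ∈ T' K \ Bad' K t, ∀ τ ∈ T K \ Bad K t, 0 < M K t σ τ)
    (hsupp : ∀ (K : ℕ) (t : ℝ), |t| ≤ l₀ → ∀ σ ∈ T' K \ Bad' K t, ∀ τ ∈ T K, τ ∈ Bad K t → M K t σ τ = 0)
    (hdiam : ∀ (K : ℕ) (t : ℝ), |t| ≤ l₀ → ∀ σ ∈ T' K \ Bad' K t, ∀ σ' ∈ T' K \ Bad' K t, ∀ τ ∈ T K \ Bad K t, ∀ τ' ∈ T K \ Bad K t,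
      M K t σ τ * M K t σ' τ' ≤ Real.exp (Δ K) * (M K t σ τ' * M K t σ' τ))
    (hosc : ∀ (K : ℕ) (t : ℝ), |t| ≤ l₀ → ∀ τ ∈ T K \ Bad K t, ∀ τ' ∈ T K \ Bad K t,
      (Real.log (Q K t τ) - Real.log (P K t τ)) - (Real.log (Q K t τ') - Real.log (P K t τ')) ≤ ω K) :
    ∀ (K : ℕ) (t : ℝ), |t| ≤ l₀ → ∀ σ ∈ T' K \ Bad' K t, ∀ σ' ∈ T' K \ Bad' K t,
      (Real.log (∑ τ ∈ T K, M K t σ τ * Q K t τ) - Real.log (∑ τ ∈ T K, M K t σ τ * P K t τ)) -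
        (Real.log (∑ τ ∈ T K, M K t σ' τ * Q K t τ) - Real.log (∑ τ ∈ T K, M K t σ' τ * P K t τ)) ≤ Real.tanh (Δ K / 4) * ω K := by
  intro K t ht σ hσ σ' hσ'
  rw [sum_eq_sum_good (Q K t) (hsupp K t ht σ hσ), sum_eq_sum_good (P K t) (hsupp K t ht σ hσ),
    sum_eq_sum_good (Q K t) (hsupp K t ht σ' hσ'), sum_eq_sum_good (P K t) (hsupp K t ht σ' hσ')]
  rcases (T K \ Bad K t).eq_empty_or_nonempty with he | hne
  · simp only [he, Finset.sum_empty, sub_self]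
    exact mul_nonneg (tanh_quarter_nonneg (hΔ K)) (hω K)
  have hAP : 0 < ∑ τ ∈ T K \ Bad K t, M K t σ τ * P K t τ := sum_pos (fun τ hτ => mul_pos (hM K t ht σ hσ τ hτ) (hP K t ht τ hτ)) hne
  have hAQ : 0 < ∑ τ ∈ T K \ Bad K t, M K t σ τ * Q K t τ := sum_pos (fun τ hτ => mul_pos (hM K t ht σ hσ τ hτ) (hQ K t ht τ hτ)) hne
  have hBP : 0 < ∑ τ ∈ T K \ Bad K t, M K t σ' τ * P K t τ := sum_pos (fun τ hτ => mul_pos (hM K t ht σ' hσ' τ hτ) (hP K t ht τ hτ)) hne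
  have hBQ : 0 < ∑ τ ∈ T K \ Bad K t, M K t σ' τ * Q K t τ := sum_pos (fun τ hτ => mul_pos (hM K t ht σ' hσ' τ hτ) (hQ K t ht τ hτ)) hne
  refine logRatio_sub_le_of_mul_le_exp_mul hAP hAQ hBP hBQ ?_
  exact two_rows_le_exp_tanh_mul (s := T K \ Bad K t) (a := M K t σ) (b := M K t σ') (x := P K t) (y := Q K t) (hω K) (hΔ K)
    (hM K t ht σ hσ) (hM K t ht σ' hσ') (hP K t ht) (hQ K t ht)
    (fun τ hτ τ' hτ' => mul_le_exp_mul_of_logRatio_sub_le (hP K t ht τ hτ) (hQ K t ht τ hτ) (hP K t ht τ' hτ') (hQ K t ht τ' hτ')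
      (hosc K t ht τ hτ τ' hτ'))
    (fun τ hτ τ' hτ' => hdiam K t ht σ hσ σ' hσ' τ hτ τ' hτ')

end ClassHalf

/-! ## §4 The geometric mechanism, end to end: `K` common steps at level `K` ⇒ class-oscillation `≤ tanh(Δ∕4)^K·ω₀` ⇒ N19's edge -/

section Chain

variable {σ : Type*} [DecidableEq σ] {l₀ vol ω₀ Δ : ℝ} {S : ℕ → Finset σ} {M : ℕ → ℕ → ℝ → σ → σ → ℝ}
  {X Y : ℕ → ℕ → ℝ → σ → ℝ}

omit [DecidableEq σ] in
/-- positivity is preserved along a chain of positive steps. [folklore] -/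
theorem chain_pos (hM : ∀ (K j : ℕ) (t : ℝ), |t| ≤ l₀ → ∀ s ∈ S K, ∀ s' ∈ S K, 0 < M K j t s s')
    (hX0 : ∀ (K : ℕ) (t : ℝ), |t| ≤ l₀ → ∀ s ∈ S K, 0 < X K 0 t s)
    (hXs : ∀ (K j : ℕ) (t : ℝ), |t| ≤ l₀ → ∀ s ∈ S K, X K (j + 1) t s = ∑ s' ∈ S K, M K j t s s' * X K j t s')
    (K n : ℕ) (t : ℝ) (ht : |t| ≤ l₀) : ∀ s ∈ S K, 0 < X K n t s := by
  induction n with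
  | zero => exact hX0 K t ht
  | succ n ih =>
    intro s hs
    rw [hXs K n t ht s hs]
    exact sum_pos (fun s' hs' => mul_pos (hM K n t ht s hs s' hs') (ih s' hs')) ⟨s, hs⟩

omit [DecidableEq σ] in
/-- **★★ THE CLASS-OSCILLATION AFTER `K` COMMON STEPS IS `≤ tanh(Δ∕4)^K · ω₀`** [folklore].  At every level `K` and source value `|t| ≤ l₀` let the two runs'
class vectors evolve by the SAME positive steps `M K j t` (`j < K`) of cross-ratio diameter `≤ Δ` on `S K × S K`
(`X K (j+1) t s = Σ_{s′} M K j t s s′ · X K j t s′`, same for `Y`), from positive initial vectors whose class-oscillation of `log(Y∕X)` is `≤ ω₀`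
(NOT assumed small).  Then after `K` steps the class-oscillation is `≤ tanh(Δ∕4)^K · ω₀` (`…N19BirkhoffContraction.chain_dist_le_pow` BY NAME). -/
theorem classOsc_chain_le_pow (hω₀ : 0 ≤ ω₀) (hΔ : 0 ≤ Δ)
    (hM : ∀ (K j : ℕ) (t : ℝ), |t| ≤ l₀ → ∀ s ∈ S K, ∀ s' ∈ S K, 0 < M K j t s s')
    (hdiam : ∀ (K j : ℕ) (t : ℝ), |t| ≤ l₀ → ∀ s ∈ S K, ∀ r ∈ S K, ∀ s' ∈ S K, ∀ r' ∈ S K,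
      M K j t s s' * M K j t r r' ≤ Real.exp Δ * (M K j t s r' * M K j t r s'))
    (hX0 : ∀ (K : ℕ) (t : ℝ), |t| ≤ l₀ → ∀ s ∈ S K, 0 < X K 0 t s) (hY0 : ∀ (K : ℕ) (t : ℝ), |t| ≤ l₀ → ∀ s ∈ S K, 0 < Y K 0 t s)
    (hXs : ∀ (K j : ℕ) (t : ℝ), |t| ≤ l₀ → ∀ s ∈ S K, X K (j + 1) t s = ∑ s' ∈ S K, M K j t s s' * X K j t s')
    (hYs : ∀ (K j : ℕ) (t : ℝ), |t| ≤ l₀ → ∀ s ∈ S K, Y K (j + 1) t s = ∑ s' ∈ S K, M K j t s s' * Y K j t s')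
    (hosc0 : ∀ (K : ℕ) (t : ℝ), |t| ≤ l₀ → ∀ s ∈ S K, ∀ s' ∈ S K,
      (Real.log (Y K 0 t s) - Real.log (X K 0 t s)) - (Real.log (Y K 0 t s') - Real.log (X K 0 t s')) ≤ ω₀) :
    ∀ (K : ℕ) (t : ℝ), |t| ≤ l₀ → ∀ s ∈ S K, ∀ s' ∈ S K,
      (Real.log (Y K K t s) - Real.log (X K K t s)) - (Real.log (Y K K t s') - Real.log (X K K t s')) ≤ Real.tanh (Δ / 4) ^ K * ω₀ := by
  intro K t ht s hs s' hs'
  have hXK := chain_pos hM hX0 hXs K K t ht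
  have hYK := chain_pos hM hY0 hYs K K t ht
  refine logRatio_sub_le_of_mul_le_exp_mul (hXK s hs) (hYK s hs) (hXK s' hs') (hYK s' hs') ?_
  exact chain_dist_le_pow (S K) (fun j => M K j t) (fun j => X K j t) (fun j => Y K j t) hω₀ hΔ
    (fun j a ha b hb => hM K j t ht a ha b hb) (fun j a ha b hb c hc e he => hdiam K j t ht a ha b hb c hc e he)
    (hX0 K t ht) (hY0 K t ht) (fun j a ha => hXs K j t ht a ha) (fun j a ha => hYs K j t ht a ha)
    (fun a ha b hb => mul_le_exp_mul_of_logRatio_sub_le (hX0 K t ht a ha) (hY0 K t ht a ha) (hX0 K t ht b hb) (hY0 K t ht b hb)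
      (hosc0 K t ht a ha b hb)) K s hs s' hs'

/-- **★★★ N19's EDGE FROM THE TOTALS AND `K` COMMON STEPS** [folklore ∘ dag-n19-w1 BY NAME].  Under the hypotheses of `classOsc_chain_le_pow`, if in
addition `0 < vol` and the TOTALS of the final vectors are matched source-uniformly modulo ONE constant per level at a SUMMABLE rate `δ` (node U5's
DECL-target currency `MatchingModConstants` read at one class: `e^{c_K − vol·δ_K}·Σ_S X K K t ≤ Σ_S Y K K t ≤ e^{c_K + vol·δ_K}·Σ_S X K K t`), then N19's
slot holds for the final cores: `∃ δ′, NE7.Core l₀ vol S ∅ (X · ·) (Y · ·) δ′ ∧ Summable δ′` — dag-n19-w1's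
`N19RekeyingAscent.coreEdge_of_totals_of_classOsc` with the GEOMETRIC class-oscillation `tanh(Δ∕4)^K·ω₀ = 2·vol·ε_K`,
`Σ ε_K < ∞` (`…N19BirkhoffContraction.summable_tanh_quarter_pow_mul`).  ONE birth of size `ω₀` at stage `0`, `K` contractions: compare this seat's g2
`…N19CoreScaleChain.not_summable_chainRadius_of_const_birth` (a constant birth at EVERY level is not summable). -/
theorem coreEdge_of_totals_of_commonSteps (hvol : 0 < vol) (hω₀ : 0 ≤ ω₀) (hΔ : 0 ≤ Δ)
    (hM : ∀ (K j : ℕ) (t : ℝ), |t| ≤ l₀ → ∀ s ∈ S K, ∀ s' ∈ S K, 0 < M K j t s s')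
    (hdiam : ∀ (K j : ℕ) (t : ℝ), |t| ≤ l₀ → ∀ s ∈ S K, ∀ r ∈ S K, ∀ s' ∈ S K, ∀ r' ∈ S K,
      M K j t s s' * M K j t r r' ≤ Real.exp Δ * (M K j t s r' * M K j t r s'))
    (hX0 : ∀ (K : ℕ) (t : ℝ), |t| ≤ l₀ → ∀ s ∈ S K, 0 < X K 0 t s) (hY0 : ∀ (K : ℕ) (t : ℝ), |t| ≤ l₀ → ∀ s ∈ S K, 0 < Y K 0 t s)
    (hXs : ∀ (K j : ℕ) (t : ℝ), |t| ≤ l₀ → ∀ s ∈ S K, X K (j + 1) t s = ∑ s' ∈ S K, M K j t s s' * X K j t s')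
    (hYs : ∀ (K j : ℕ) (t : ℝ), |t| ≤ l₀ → ∀ s ∈ S K, Y K (j + 1) t s = ∑ s' ∈ S K, M K j t s s' * Y K j t s')
    (hosc0 : ∀ (K : ℕ) (t : ℝ), |t| ≤ l₀ → ∀ s ∈ S K, ∀ s' ∈ S K,
      (Real.log (Y K 0 t s) - Real.log (X K 0 t s)) - (Real.log (Y K 0 t s') - Real.log (X K 0 t s')) ≤ ω₀)
    (hT : ∃ δ : ℕ → ℝ, (∀ K : ℕ, ∃ c : ℝ, ∀ t : ℝ, |t| ≤ l₀ →
      Real.exp (c - vol * δ K) * ∑ s ∈ S K, X K K t s ≤ ∑ s ∈ S K, Y K K t s ∧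
        ∑ s ∈ S K, Y K K t s ≤ Real.exp (c + vol * δ K) * ∑ s ∈ S K, X K K t s) ∧ Summable δ) :
    ∃ δ' : ℕ → ℝ, NE7.Core l₀ vol S (fun _ _ => ∅) (fun K t s => X K K t s) (fun K t s => Y K K t s) δ' ∧ Summable δ' := by
  have hchain := classOsc_chain_le_pow hω₀ hΔ hM hdiam hX0 hY0 hXs hYs hosc0
  refine coreEdge_of_totals_of_classOsc (p := fun K t s => X K K t s) (q := fun K t s => Y K K t s)
    (fun K t ht s hs => chain_pos hM hX0 hXs K K t ht s hs) (fun K t ht s hs => chain_pos hM hY0 hYs K K t ht s hs) hT ?_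
  refine ⟨fun K => Real.tanh (Δ / 4) ^ K * ω₀ / (2 * vol), fun K t ht s hs s' hs' => ?_,
    (summable_tanh_quarter_pow_mul hΔ ω₀).div_const (2 * vol)⟩
  have e : 2 * (vol * (Real.tanh (Δ / 4) ^ K * ω₀ / (2 * vol))) = Real.tanh (Δ / 4) ^ K * ω₀ := by
    field_simp
  rw [e]
  exact hchain K t ht s hs s' hs'

end Chain

end Summit.QuantumFields.YangMills.BalabanUVNodes.N19CoreCommonStep

end
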